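import Mathlib
import Literature.MathematicalPhysics.QuantumFieldTheory.Balaban1983to89.B5Prop11Lower

/-!
# T⁴ programme, SUBSTRATE (shared lattice-gauge analysis library) — THE GAUSSIAN LETTERS `N`, `q` OF NE5's (2.14)-CORE SOCKET
# `B13TermContourCore.ofContours … N q …`, READ OFF AN OPERATOR DATUM through a flat-coordinate quadratic form, WITH THE FOUR OPERATOR
# BINDERS OF `B13TermParamGaussianBi.termGaussianParamBi_termBi` DISCHARGED (holomorphy in the datum, measurability in the contour
# parameter, the affine margin, the normalisation bound) — item S-U3 letters (typed: `substrate/typer/SubstrateSketch.v0.3` §U3; MAP v0.3 §4 p3 (3))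

Substrate cell `b2b-balaban-substrate-*`, seat p3.  NE5's one (2.14)-core of record (`B13TermParamGaussianBi.BiCore P dom Op PΛ V`, p215679;
constructor `B13TermContourCore.ofContours P dom Jc hκ hr N q cons nsign B measB`, p216447) takes two OPERATOR LETTERS: the Gaussian
normalisation `N : Op → PΛ → ℂ` and the exponent `q : Op → PΛ → V → ℂ`; the term is `∫ w(p)·N(o,p)·(∫ chi(v)·e^{readOut}·e^{−q(o,p,v)} dv) dlam(p)`
(`termBi`) and the shape of record holds PROVIDED (`termGaussianParamBi_termBi`, binders `hN`, `hq`): on the open operator ball of every class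
centre, `N(o,·)` is a.e.-strongly measurable, `N(·,p)` holomorphic, `‖N‖ ≤ N₀`; `q(o,·,·)` jointly a.e.-strongly measurable, `q(·,p,v)`
holomorphic, `m‖v‖² − b ≤ Re q`.  THIS FILE supplies the canonical Gaussian pair for «the centred Gaussian with quadratic form `A(o,p)` in flat
fibre coordinates» and PROVES those binders from three properties of the READING `form : Op → PΛ → Matrix m m ℂ` (the reduced quadratic form of
the step's fluctuation action ∕ inverse interpolated covariance on the fibre, in `card m` flat coordinates `coords : V →ₗᵢ[ℝ] EuclideanSpace ℝ m`
— WHICH matrix is read (p1's `SubstrateRawSpecies` conventions, `deltaKer`∕`cov` slots, the (1.19) constraints already solved into the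
coordinates) is the instance's business; here it is a parameter):
 * §1 **`gaussQ form coords o p v = ½·Σ_{ij} x_i·A(o,p)_{ij}·x_j`**, `x = coords v` (`gaussQ_eq_dotProduct`), its polar form `gaussB` (`gaussB_self`,
   `gaussB_symm` for symmetric `A`), homogeneity `gaussQ_smul`; **`differentiableOn_gaussQ`** (holomorphic in `o` wherever every entry
   `o ↦ A(o,p)_{ij}` is), **`measurable_gaussQ`** (jointly measurable in `(p, v)` when every entry is measurable in `p`), and the MARGIN
   **`re_gaussQ_ge`**: `γ‖x‖² ≤ Re⟨x, A(o,p)x⟩` for all complex `x` (the tree's `Coercive γ (A o p)` shape, written out) ⟹ `(γ/2)·‖v‖² ≤ Re gaussQ`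
   (so `m := γ/2`, `b := 0`);
 * §2 **`gaussN form o p = (2π)^{−card m/2}·det(A(o,p))^{1/2}`** (principal branch: `exp(log det ∕ 2)`; at `det = 0` Mathlib's `log 0 = 0` gives the
   harmless junk value `(2π)^{−card m/2}`): `gaussN_ne_zero`, `gaussN_sq` (`= (2π)^{−card m}·det` for `det ≠ 0`), `norm_gaussN` ∕ **`norm_gaussN_le`**
   (`‖N‖ ≤ (2π)^{−card m/2}·√D` from `‖det‖ ≤ D`, `1 ≤ D`), **`measurable_gaussN`**, and **`differentiableOn_gaussN`** (holomorphic in `o` on any set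
   where the entries are holomorphic AND `det(A(o,p))` stays in `Complex.slitPlane`) with the sufficient condition
   `mem_slitPlane_of_norm_sub_lt` (`‖det − d₀‖ < d₀`, `d₀ > 0` real: a small operator ball around a real positive-definite centre);
 * §3 the AFFINE READING **`linForm base rd o p = base p + (rd p)(o)`** (entries `base p i j + rd p i j o`, `rd p i j : Op →L[ℂ] ℂ` — e.g. a
   finite combination of NE5's `B13OpDatum.entryCLM`), for which holomorphy is automatic (`differentiableOn_linForm`), measurability reduces to
   that of `base` and `p ↦ rd p i j o` (`measurable_linForm`), and coercivity PERSISTS on the operator ball: `γ`-coercive `base p` and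
   `‖rd p i j‖ ≤ ϑ` at the centre `c` give `(γ − card m·ϑ·R′)`-coercivity of `linForm base rd o p` for `‖o − c‖ ≤ R′`
   (`coercive_linForm_of_norm_sub_le`, via the entrywise perturbation lemma `norm_form_le_of_entry_le`; literal margin `margin_gaussQ_linForm`).
So p1's `CoreLetters` instance is ONE record literal `N := gaussN (linForm base rd)`, `q := gaussQ (linForm base rd) coords`, and the `hN`∕`hq`
binders of `termGaussianParamBi_termBi` are the theorems above (the determinant bound `D` and the slit-plane condition being the two
displayed smallness conditions on the operator radius `R′`).

HONEST FRAMING (T4-DAG p. 1).  Finite-dimensional Gaussian bookkeeping ([folklore]); the identity `N·∫e^{−q} = 1` (real positive-definite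
case) is NOT proved here and NOT used by the socket (which consumes only the binders); which Gaussian of [Balaban1988RG2Cluster] (2.14)∕(2.20)
the instance reads is p1's∕NE5's modelling call; no estimate of any NE row; nothing printed is a hypothesis or a conclusion; no `def … : Prop`;
spine 0/9 unchanged; NOT infinite volume ∕ mass gap ∕ Clay.  HONEST DEPENDENCY: continuum YM on T⁴ ⇐ BetaPertH ∧ nine spine estimates (0/9
proved); BetaPertH ⇐ (D1) ∧ (D4) ∧ CAP+tail; G-an2-4 gates asym, D1 and NE2/3/4.  ABSOLUTE RULE kept; no `sorry`.
-/

noncomputable section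

open scoped BigOperators ComplexConjugate Matrix
open MeasureTheory

namespace Summit.QuantumFields.BalabanUV.T4Continuum.SubstrateGaussianLetters

open Literature.MathematicalPhysics.QuantumFieldTheory.Balaban1983to89.B5Prop11Lower (nsq nsq_nonneg)

variable {Op PΛ : Type*} {m : Type*} [Fintype m] [DecidableEq m]
variable {V : Type*} [NormedAddCommGroup V] [InnerProductSpace ℝ V]

/-! ## §1 The exponent letter `q` -/

/-- the flat fibre coordinates of `v`, complexified: `x_i = (coords v)_i`. [folklore] -/
def cvec (coords : V →ₗᵢ[ℝ] EuclideanSpace ℝ m) (v : V) : m → ℂ := fun i => ((coords v i : ℝ) : ℂ)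

omit [DecidableEq m] in
/-- `cvec` is real: `star x = x`. [folklore] -/
theorem star_cvec (coords : V →ₗᵢ[ℝ] EuclideanSpace ℝ m) (v : V) : star (cvec coords v) = cvec coords v := by
  funext i; simp [cvec]

omit [DecidableEq m] in
/-- `Σ|x_i|² = ‖v‖²` (the coordinates are isometric). [folklore] -/
theorem nsq_cvec (coords : V →ₗᵢ[ℝ] EuclideanSpace ℝ m) (v : V) : nsq (cvec coords v) = ‖v‖ ^ 2 := by
  rw [← coords.norm_map v, EuclideanSpace.norm_eq, Real.sq_sqrt (Finset.sum_nonneg fun i _ => sq_nonneg _), nsq]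
  exact Finset.sum_congr rfl fun i _ => by rw [cvec, Complex.norm_real]

omit [DecidableEq m] in
/-- `cvec (t•v) = t•cvec v`. [folklore] -/
theorem cvec_smul (coords : V →ₗᵢ[ℝ] EuclideanSpace ℝ m) (t : ℝ) (v : V) : cvec coords (t • v) = fun i => (t : ℂ) * cvec coords v i := by
  funext i; simp [cvec, map_smul]

/-- **the polar (bilinear) form** `gaussB A o p v w = ½·Σ_{ij} x_i(v)·A(o,p)_{ij}·x_j(w)`. [folklore] -/
def gaussB (form : Op → PΛ → Matrix m m ℂ) (coords : V →ₗᵢ[ℝ] EuclideanSpace ℝ m) (o : Op) (p : PΛ) (v w : V) : ℂ :=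
  (1 / 2 : ℂ) * ∑ i, ∑ j, cvec coords v i * form o p i j * cvec coords w j

/-- **THE EXPONENT LETTER** `gaussQ A o p v = ½·Σ_{ij} x_i·A(o,p)_{ij}·x_j`, `x = coords v` — the quadratic form of the reduced Gaussian datum
`A(o,p)` in flat fibre coordinates (the `q` of `B13TermContourCore.ofContours`). [folklore] -/
def gaussQ (form : Op → PΛ → Matrix m m ℂ) (coords : V →ₗᵢ[ℝ] EuclideanSpace ℝ m) (o : Op) (p : PΛ) (v : V) : ℂ :=
  (1 / 2 : ℂ) * ∑ i, ∑ j, cvec coords v i * form o p i j * cvec coords v j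

variable (form : Op → PΛ → Matrix m m ℂ) (coords : V →ₗᵢ[ℝ] EuclideanSpace ℝ m)

omit [DecidableEq m] in
/-- `q(v) = B(v, v)`. [folklore] -/
theorem gaussB_self (o : Op) (p : PΛ) (v : V) : gaussB form coords o p v v = gaussQ form coords o p v := rfl

omit [DecidableEq m] in
/-- the polar form is symmetric when `A(o,p)` is a symmetric matrix. [folklore] -/
theorem gaussB_symm {o : Op} {p : PΛ} (hsym : (form o p).transpose = form o p) (v w : V) :
    gaussB form coords o p v w = gaussB form coords o p w v := by
  unfold gaussB
  congr 1
  rw [Finset.sum_comm]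
  refine Finset.sum_congr rfl fun i _ => Finset.sum_congr rfl fun j _ => ?_
  rw [show form o p j i = form o p i j from by rw [← Matrix.transpose_apply (form o p) i j, hsym]]
  ring

omit [DecidableEq m] in
/-- `q = ½⟨x, A x⟩` as a dot product (`x` real, so `star x = x`). [folklore] -/
theorem gaussQ_eq_dotProduct (o : Op) (p : PΛ) (v : V) :
    gaussQ form coords o p v = (1 / 2 : ℂ) * (star (cvec coords v) ⬝ᵥ (form o p *ᵥ cvec coords v)) := by
  rw [gaussQ, star_cvec, dotProduct]
  congr 1
  refine Finset.sum_congr rfl fun i _ => ?_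
  rw [Matrix.mulVec, dotProduct, Finset.mul_sum]
  exact Finset.sum_congr rfl fun j _ => by ring

omit [DecidableEq m] in
/-- homogeneity of degree two: `q(t•v) = t²·q(v)`. [folklore] -/
theorem gaussQ_smul (o : Op) (p : PΛ) (t : ℝ) (v : V) : gaussQ form coords o p (t • v) = (t : ℂ) ^ 2 * gaussQ form coords o p v := by
  simp only [gaussQ, cvec_smul, Finset.mul_sum]
  refine Finset.sum_congr rfl fun i _ => Finset.sum_congr rfl fun j _ => ?_
  ring

omit [DecidableEq m] in
/-- **HOLOMORPHY BINDER for `q`**: if every entry `o ↦ A(o,p)_{ij}` is holomorphic on `U`, so is `o ↦ q(o,p,v)`. [folklore] -/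
theorem differentiableOn_gaussQ [NormedAddCommGroup Op] [NormedSpace ℂ Op] {U : Set Op} {p : PΛ}
    (hform : ∀ i j, DifferentiableOn ℂ (fun o => form o p i j) U) (v : V) :
    DifferentiableOn ℂ (fun o => gaussQ form coords o p v) U := by
  unfold gaussQ
  refine DifferentiableOn.const_mul (DifferentiableOn.fun_sum fun i _ => DifferentiableOn.fun_sum fun j _ => ?_) _
  exact ((differentiableOn_const _).mul (hform i j)).mul (differentiableOn_const _)

omit [DecidableEq m] in
/-- **MEASURABILITY BINDER for `q`**: if every entry `p ↦ A(o,p)_{ij}` is measurable, `(p, v) ↦ q(o,p,v)` is jointly measurable (hence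
a.e.-strongly measurable for every product measure). [folklore] -/
theorem measurable_gaussQ [MeasurableSpace PΛ] [MeasurableSpace V] [BorelSpace V] {o : Op}
    (hform : ∀ i j, Measurable fun p => form o p i j) : Measurable (Function.uncurry (gaussQ form coords o)) := by
  have hx : ∀ i, Measurable fun q : PΛ × V => cvec coords q.2 i := by
    intro i
    have hc : Continuous fun v : V => cvec coords v i :=
      Complex.continuous_ofReal.comp ((EuclideanSpace.proj i).continuous.comp coords.continuous)
    exact hc.measurable.comp measurable_snd
  have h : Function.uncurry (gaussQ form coords o)
      = fun q : PΛ × V => (1 / 2 : ℂ) * ∑ i, ∑ j, cvec coords q.2 i * form o q.1 i j * cvec coords q.2 j := by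
    funext q; rfl
  rw [h]
  refine Measurable.const_mul (Finset.measurable_fun_sum _ fun i _ => Finset.measurable_fun_sum _ fun j _ => ?_) _
  exact ((hx i).mul ((hform i j).comp measurable_fst)).mul (hx j)

omit [DecidableEq m] in
/-- a.e.-strong measurability of `q(o,·,·)` for any pair of measures (the literal `hq` clause). [folklore] -/
theorem aestronglyMeasurable_gaussQ [MeasurableSpace PΛ] [MeasurableSpace V] [BorelSpace V] {o : Op}
    (hform : ∀ i j, Measurable fun p => form o p i j) (lam : Measure PΛ) (μ : Measure V) :
    AEStronglyMeasurable (Function.uncurry (gaussQ form coords o)) (lam.prod μ) :=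
  (measurable_gaussQ form coords hform).aestronglyMeasurable

omit [DecidableEq m] in
/-- **THE MARGIN BINDER for `q`** (`b = 0`): if `A(o,p)` is `γ`-coercive — `γ·Σ|x_i|² ≤ Re⟨x, A(o,p)x⟩` for every complex `x` (the tree's
`CoerciveInverseTower.Coercive γ (form o p)`, written out) — then `(γ/2)·‖v‖² ≤ Re q(o,p,v)`. [folklore] -/
theorem re_gaussQ_ge {o : Op} {p : PΛ} {γ : ℝ} (hco : ∀ x : m → ℂ, γ * nsq x ≤ (star x ⬝ᵥ (form o p *ᵥ x)).re) (v : V) :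
    γ / 2 * ‖v‖ ^ 2 ≤ (gaussQ form coords o p v).re := by
  rw [gaussQ_eq_dotProduct, Complex.mul_re, show (1 / 2 : ℂ).im = 0 by norm_num, zero_mul, sub_zero, show (1 / 2 : ℂ).re = 1 / 2 by norm_num,
    ← nsq_cvec coords v]
  have h := hco (cvec coords v)
  linarith

omit [DecidableEq m] in
/-- the margin binder in the literal `hq` shape `m‖v‖² − b ≤ Re q` with `m = γ/2`, `b = 0`. [folklore] -/
theorem margin_gaussQ {o : Op} {p : PΛ} {γ : ℝ} (hco : ∀ x : m → ℂ, γ * nsq x ≤ (star x ⬝ᵥ (form o p *ᵥ x)).re) (v : V) :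
    γ / 2 * ‖v‖ ^ 2 - 0 ≤ (gaussQ form coords o p v).re := by
  rw [sub_zero]; exact re_gaussQ_ge form coords hco v

/-! ## §2 The normalisation letter `N` -/

/-- the Gaussian constant `(2π)^{−card m/2}`. [folklore] -/
def gaussC (m : Type*) [Fintype m] : ℝ := (Real.sqrt (2 * Real.pi))⁻¹ ^ Fintype.card m

omit [DecidableEq m] in
/-- `(2π)^{−card m/2} > 0`. [folklore] -/
theorem gaussC_pos : 0 < gaussC m := by unfold gaussC; positivity

/-- **THE NORMALISATION LETTER** `gaussN A o p = (2π)^{−card m/2}·det(A(o,p))^{1/2}` (principal branch `exp(log det ∕ 2)`; the `N` of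
`B13TermContourCore.ofContours`).  At `det = 0` the value is the junk `(2π)^{−card m/2}` (Mathlib `log 0 = 0`), never met on a coercive ball.
[folklore] -/
def gaussN (form : Op → PΛ → Matrix m m ℂ) (o : Op) (p : PΛ) : ℂ := (gaussC m : ℂ) * Complex.exp (Complex.log (form o p).det / 2)

/-- `N ≠ 0`. [folklore] -/
theorem gaussN_ne_zero (o : Op) (p : PΛ) : gaussN form o p ≠ 0 :=
  mul_ne_zero (by exact_mod_cast (gaussC_pos (m := m)).ne') (Complex.exp_ne_zero _)

/-- `N² = (2π)^{−card m}·det A` (for `det ≠ 0`). [folklore] -/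
theorem gaussN_sq {o : Op} {p : PΛ} (hdet : (form o p).det ≠ 0) : gaussN form o p ^ 2 = (gaussC m : ℂ) ^ 2 * (form o p).det := by
  rw [gaussN, mul_pow, sq (Complex.exp _), ← Complex.exp_add, add_halves, Complex.exp_log hdet]

/-- `‖exp(log d ∕ 2)‖ = √‖d‖` for `d ≠ 0`. [folklore] -/
theorem norm_exp_log_half {d : ℂ} (hd : d ≠ 0) : ‖Complex.exp (Complex.log d / 2)‖ = Real.sqrt ‖d‖ := by
  have hpos : 0 < ‖d‖ := norm_pos_iff.mpr hd
  have hre : (Complex.log d / 2).re = Real.log ‖d‖ / 2 := by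
    have h2 : (Complex.log d / 2) = Complex.log d * ((1 / 2 : ℝ) : ℂ) := by push_cast; ring
    rw [h2, Complex.re_mul_ofReal, Complex.log_re]; ring
  rw [Complex.norm_exp, hre, Real.sqrt_eq_rpow, Real.rpow_def_of_pos hpos]
  congr 1; ring

/-- `‖N‖ = (2π)^{−card m/2}·√‖det A‖` (for `det ≠ 0`). [folklore] -/
theorem norm_gaussN {o : Op} {p : PΛ} (hdet : (form o p).det ≠ 0) : ‖gaussN form o p‖ = gaussC m * Real.sqrt ‖(form o p).det‖ := by
  rw [gaussN, norm_mul, Complex.norm_real, Real.norm_of_nonneg (gaussC_pos (m := m)).le, norm_exp_log_half hdet]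

/-- **THE BOUND BINDER for `N`**: `‖det A(o,p)‖ ≤ D` with `1 ≤ D` gives `‖N(o,p)‖ ≤ (2π)^{−card m/2}·√D` (also at `det = 0`). [folklore] -/
theorem norm_gaussN_le {o : Op} {p : PΛ} {D : ℝ} (hD : ‖(form o p).det‖ ≤ D) (hD1 : 1 ≤ D) : ‖gaussN form o p‖ ≤ gaussC m * Real.sqrt D := by
  by_cases hdet : (form o p).det = 0
  · rw [gaussN, hdet, Complex.log_zero, zero_div, Complex.exp_zero, mul_one, Complex.norm_real, Real.norm_of_nonneg (gaussC_pos (m := m)).le]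
    exact le_mul_of_one_le_right (gaussC_pos (m := m)).le (Real.one_le_sqrt.mpr hD1)
  · rw [norm_gaussN form hdet]
    exact mul_le_mul_of_nonneg_left (Real.sqrt_le_sqrt hD) (gaussC_pos (m := m)).le

/-- the determinant of an entrywise-measurable matrix function is measurable (Leibniz expansion). [folklore] -/
theorem measurable_det [MeasurableSpace PΛ] {A : PΛ → Matrix m m ℂ} (hA : ∀ i j, Measurable fun p => A p i j) :
    Measurable fun p => (A p).det := by
  have h : (fun p => (A p).det) = fun p => ∑ σ : Equiv.Perm m, ((Equiv.Perm.sign σ : ℤ) : ℂ) * ∏ i, A p (σ i) i := by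
    funext p
    rw [Matrix.det_apply]
    exact Finset.sum_congr rfl fun σ _ => by rw [Units.smul_def, zsmul_eq_mul]
  rw [h]
  exact Finset.measurable_fun_sum _ fun σ _ => (Finset.measurable_fun_prod _ fun i _ => hA (σ i) i).const_mul _

/-- **THE MEASURABILITY BINDER for `N`**: entrywise measurability of `p ↦ A(o,p)` gives measurability of `p ↦ N(o,p)`. [folklore] -/
theorem measurable_gaussN [MeasurableSpace PΛ] {o : Op} (hform : ∀ i j, Measurable fun p => form o p i j) :
    Measurable fun p => gaussN form o p :=
  (Complex.measurable_exp.comp ((Complex.measurable_log.comp (measurable_det hform)).div_const _)).const_mul _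

/-- a finite product of functions holomorphic on `U` is holomorphic on `U`. [folklore] -/
theorem differentiableOn_finset_prod [NormedAddCommGroup Op] [NormedSpace ℂ Op] {U : Set Op} {ι : Type*} (s : Finset ι) {f : ι → Op → ℂ}
    (hf : ∀ i ∈ s, DifferentiableOn ℂ (f i) U) : DifferentiableOn ℂ (fun o => ∏ i ∈ s, f i o) U := by
  classical
  induction s using Finset.induction_on with
  | empty => simp only [Finset.prod_empty]; exact differentiableOn_const _
  | insert a s ha ih =>
    simp only [Finset.prod_insert ha]
    exact (hf a (Finset.mem_insert_self a s)).mul (ih fun i hi => hf i (Finset.mem_insert_of_mem hi))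

/-- the determinant of an entrywise-holomorphic matrix function is holomorphic (Leibniz expansion). [folklore] -/
theorem differentiableOn_det [NormedAddCommGroup Op] [NormedSpace ℂ Op] {U : Set Op} {A : Op → Matrix m m ℂ}
    (hA : ∀ i j, DifferentiableOn ℂ (fun o => A o i j) U) : DifferentiableOn ℂ (fun o => (A o).det) U := by
  have h : (fun o => (A o).det) = fun o => ∑ σ : Equiv.Perm m, ((Equiv.Perm.sign σ : ℤ) : ℂ) * ∏ i, A o (σ i) i := by
    funext o
    rw [Matrix.det_apply]
    exact Finset.sum_congr rfl fun σ _ => by rw [Units.smul_def, zsmul_eq_mul]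
  rw [h]
  exact DifferentiableOn.fun_sum fun σ _ => (differentiableOn_finset_prod _ fun i _ => hA (σ i) i).const_mul _

/-- **THE HOLOMORPHY BINDER for `N`**: if every entry `o ↦ A(o,p)_{ij}` is holomorphic on `U` and `det A(o,p)` stays in the slit plane on `U`,
then `o ↦ N(o,p)` is holomorphic on `U`. [folklore] -/
theorem differentiableOn_gaussN [NormedAddCommGroup Op] [NormedSpace ℂ Op] {U : Set Op} {p : PΛ}
    (hform : ∀ i j, DifferentiableOn ℂ (fun o => form o p i j) U) (hslit : ∀ o ∈ U, (form o p).det ∈ Complex.slitPlane) :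
    DifferentiableOn ℂ (fun o => gaussN form o p) U := by
  have h : (fun o => gaussN form o p) = fun o => (gaussC m : ℂ) * Complex.exp (Complex.log (form o p).det * (1 / 2 : ℂ)) := by
    funext o; rw [gaussN, ← div_eq_mul_one_div]
  rw [h]
  exact (((differentiableOn_det hform).clog hslit).mul_const _).cexp.const_mul _

omit [Fintype m] [DecidableEq m] in
/-- the sufficient condition for the slit plane: a complex number within `d₀` of a real `d₀ > 0` is not on `(−∞, 0]`. [folklore] -/
theorem mem_slitPlane_of_norm_sub_lt {z : ℂ} {d₀ : ℝ} (hd₀ : 0 < d₀) (hz : ‖z - d₀‖ < d₀) : z ∈ Complex.slitPlane := by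
  rw [Complex.mem_slitPlane_iff]
  by_contra h
  have h1 : z.re ≤ 0 := not_lt.mp (not_or.mp h).1
  have hre : d₀ ≤ ‖z - d₀‖ := by
    calc d₀ ≤ |(z - (d₀ : ℂ)).re| := by
          rw [Complex.sub_re, Complex.ofReal_re, abs_sub_comm, abs_of_nonneg (by linarith)]; linarith
      _ ≤ ‖z - d₀‖ := Complex.abs_re_le_norm _
  linarith

/-! ## §3 The affine reading of the datum -/

section Affine

variable [NormedAddCommGroup Op] [NormedSpace ℂ Op]

/-- **the affine reading** `linForm base rd o p = base p + (rd p)(o)`: a base form plus entries read LINEARLY off the operator datum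
(`rd p i j : Op →L[ℂ] ℂ`, e.g. combinations of `B13OpDatum.entryCLM`). [folklore] -/
def linForm (base : PΛ → Matrix m m ℂ) (rd : PΛ → m → m → (Op →L[ℂ] ℂ)) (o : Op) (p : PΛ) : Matrix m m ℂ :=
  Matrix.of fun i j => base p i j + rd p i j o

variable (base : PΛ → Matrix m m ℂ) (rd : PΛ → m → m → (Op →L[ℂ] ℂ))

omit [Fintype m] [DecidableEq m] in
/-- entries. [folklore] -/
theorem linForm_apply (o : Op) (p : PΛ) (i j : m) : linForm base rd o p i j = base p i j + rd p i j o := rfl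

omit [Fintype m] [DecidableEq m] in
/-- the affine reading is holomorphic in the datum, entry by entry, everywhere. [folklore] -/
theorem differentiableOn_linForm (U : Set Op) (p : PΛ) (i j : m) : DifferentiableOn ℂ (fun o => linForm base rd o p i j) U :=
  ((differentiableOn_const _).add (rd p i j).differentiable.differentiableOn).congr fun o _ => linForm_apply base rd o p i j

omit [Fintype m] [DecidableEq m] in
/-- measurability of the affine reading in the parameter. [folklore] -/
theorem measurable_linForm [MeasurableSpace PΛ] (hbase : ∀ i j, Measurable fun p => base p i j) (hrd : ∀ i j (o : Op), Measurable fun p => rd p i j o)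
    (o : Op) (i j : m) : Measurable fun p => linForm base rd o p i j :=
  (hbase i j).add (hrd i j o)

omit [DecidableEq m] in
/-- **entrywise perturbation of a form**: `‖E_{ij}‖ ≤ ε` for all `i, j` gives `|⟨x, E x⟩| ≤ card m·ε·Σ|x_i|²`. [folklore] -/
theorem norm_form_le_of_entry_le {E : Matrix m m ℂ} {ε : ℝ} (hE : ∀ i j, ‖E i j‖ ≤ ε) (x : m → ℂ) :
    ‖star x ⬝ᵥ (E *ᵥ x)‖ ≤ Fintype.card m * ε * nsq x := by
  rcases isEmpty_or_nonempty m with hm | hm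
  · simp [dotProduct, nsq]
  have hε : 0 ≤ ε := (norm_nonneg _).trans (hE (Classical.arbitrary m) (Classical.arbitrary m))
  -- `|Σ_{ij} x̄_i E_ij x_j| ≤ ε (Σ_i |x_i|)² ≤ ε · card m · Σ |x_i|²`
  have h1 : ‖star x ⬝ᵥ (E *ᵥ x)‖ ≤ ε * (∑ i, ‖x i‖) ^ 2 := by
    calc ‖star x ⬝ᵥ (E *ᵥ x)‖ = ‖∑ i, ∑ j, star (x i) * (E i j * x j)‖ := by
          simp only [dotProduct, Matrix.mulVec, Pi.star_apply, Finset.mul_sum]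
      _ ≤ ∑ i, ∑ j, ‖x i‖ * (ε * ‖x j‖) := by
          refine (norm_sum_le _ _).trans (Finset.sum_le_sum fun i _ => (norm_sum_le _ _).trans (Finset.sum_le_sum fun j _ => ?_))
          rw [norm_mul, norm_star, norm_mul]
          exact mul_le_mul_of_nonneg_left (mul_le_mul_of_nonneg_right (hE i j) (norm_nonneg _)) (norm_nonneg _)
      _ = ε * (∑ i, ‖x i‖) ^ 2 := by
          rw [sq, Finset.sum_mul_sum, Finset.mul_sum]
          refine Finset.sum_congr rfl fun i _ => ?_
          rw [Finset.mul_sum]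
          exact Finset.sum_congr rfl fun j _ => by ring
  have h2 : (∑ i, ‖x i‖) ^ 2 ≤ Fintype.card m * nsq x := by
    have h := sq_sum_le_card_mul_sum_sq (s := Finset.univ) (f := fun i => ‖x i‖)
    simpa [nsq] using h
  calc ‖star x ⬝ᵥ (E *ᵥ x)‖ ≤ ε * (∑ i, ‖x i‖) ^ 2 := h1
    _ ≤ ε * (Fintype.card m * nsq x) := mul_le_mul_of_nonneg_left h2 hε
    _ = Fintype.card m * ε * nsq x := by ring

omit [Fintype m] [DecidableEq m] in
/-- the affine reading along the ball: `A(o,p) = A(c,p) + (rd p)(o − c)`. [folklore] -/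
theorem linForm_eq_add_sub (c o : Op) (p : PΛ) : linForm base rd o p = linForm base rd c p + Matrix.of fun i j => rd p i j (o - c) := by
  ext i j
  simp only [linForm, Matrix.add_apply, Matrix.of_apply, map_sub]
  ring

omit [DecidableEq m] in
/-- **COERCIVITY PERSISTS ON THE OPERATOR BALL**: if the reading at the centre `c` is `γ`-coercive and `‖rd p i j‖ ≤ ϑ`, then at every `o` with
`‖o − c‖ ≤ R′` the reading is `(γ − card m·ϑ·R′)`-coercive — so `re_gaussQ_ge` gives the margin `m = (γ − card m·ϑ·R′)/2` on the whole ball,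
alive iff `card m·ϑ·R′ < γ` (ARITHMETIC smallness of the operator radius). [folklore] -/
theorem coercive_linForm_of_norm_sub_le {c o : Op} {p : PΛ} {γ ϑ R' : ℝ}
    (hc : ∀ x : m → ℂ, γ * nsq x ≤ (star x ⬝ᵥ (linForm base rd c p *ᵥ x)).re) (hrd : ∀ i j, ‖rd p i j‖ ≤ ϑ) (ho : ‖o - c‖ ≤ R')
    (x : m → ℂ) : (γ - Fintype.card m * ϑ * R') * nsq x ≤ (star x ⬝ᵥ (linForm base rd o p *ᵥ x)).re := by
  have hE : ∀ i j, ‖(Matrix.of fun i j => rd p i j (o - c)) i j‖ ≤ ϑ * R' := fun i j => by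
    rw [Matrix.of_apply]
    exact ((rd p i j).le_opNorm _).trans (mul_le_mul (hrd i j) ho (norm_nonneg _) ((norm_nonneg _).trans (hrd i j)))
  have hpert := norm_form_le_of_entry_le hE x
  rw [linForm_eq_add_sub base rd c o p, Matrix.add_mulVec, dotProduct_add, Complex.add_re]
  have hre : -(Fintype.card m * (ϑ * R') * nsq x) ≤ (star x ⬝ᵥ ((Matrix.of fun i j => rd p i j (o - c)) *ᵥ x)).re := by
    have h := Complex.abs_re_le_norm (star x ⬝ᵥ ((Matrix.of fun i j => rd p i j (o - c)) *ᵥ x))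
    rw [abs_le] at h
    linarith [h.1]
  have := hc x
  nlinarith

omit [DecidableEq m] in
/-- **THE MARGIN BINDER ON THE BALL** (literal `hq` shape): `(γ − card m·ϑ·R′)/2·‖v‖² − 0 ≤ Re q(o,p,v)` for every `o ∈ ball c R′`. [folklore] -/
theorem margin_gaussQ_linForm {c : Op} {p : PΛ} {γ ϑ R' : ℝ}
    (hc : ∀ x : m → ℂ, γ * nsq x ≤ (star x ⬝ᵥ (linForm base rd c p *ᵥ x)).re) (hrd : ∀ i j, ‖rd p i j‖ ≤ ϑ)
    {o : Op} (ho : o ∈ Metric.ball c R') (v : V) :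
    (γ - Fintype.card m * ϑ * R') / 2 * ‖v‖ ^ 2 - 0 ≤ (gaussQ (linForm base rd) coords o p v).re :=
  margin_gaussQ (linForm base rd) coords (coercive_linForm_of_norm_sub_le base rd hc hrd (le_of_lt (mem_ball_iff_norm.mp ho))) v

end Affine

end Summit.QuantumFields.BalabanUV.T4Continuum.SubstrateGaussianLetters

end
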